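import Mathlib
import HarnessLib
import Summits.ResolutionOfSingularities.Statement
import Literature.AlgebraicGeometry.Resolution.ProperModelsFunctionField
import Literature.AlgebraicGeometry.Resolution.ProperModelsPatchingOfResolution
import Literature.AlgebraicGeometry.Resolution.ResolutionOfSingularities

/-!
# RadicandHessianClasses — definitions for the decomp-res node «HessianLadder» (phase 1 of the filing)

Cell decomp-res (ResolutionOfSingularities, residual mode), lens-1 g5 node HessianLadder rev 2 = CHILD NODE of the
route `QuotientModels` refining BY NAME its aside `QuotientModels.SimpleRadicialRegModelDimFour` (item stmt-27201,
SRM₄: regular proper models in dimension ≤ 4 ascend along a simple height-one purely inseparable extension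
`K = L(a)`, `aᵖ = b ∈ L`, when `L` has a regular proper model).  CRITIC-LEDGER row 35 (narrow OBJECTION, accepted by
the lens) → row 37 (2026-08-30T05:38:01Z): CLEARED AS CHILD NODE of QuotientModels:27201.  Source: HOME/
decomp-res-lens-1/g5/HessianLadder.lean rev 2 sha256 d5221834… (525 lines; critic's own `lean check` rc 0 · 0 sorry).

ORDER PARAMETER: the RANK r ∈ {0,…,4} of the Hessian (polar form) of a local representative `x = b·sᵖ (− tᵖ)` of the
radicand class at a CLOSED point of a regular proper model `N` of `L`; the root cover `zᵖ = x` is then a SUSPENSION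
`Q_r(u) + (zᵖ − g_res(v))`.  THIS FILE lands the node's typing so that the four route asides (phase 2 on route
QuotientModels: `TameRadicands` [WEAKER(evidence) = KNOWN-MOD-PORT: a decided FUNCTION-FIELD carving, standard (e)(i);
informal to say «presentation on a PROPER model, points at infinity included»], `HyperbolicRadicands` [UNDECIDED(test
T-hyp-descent) · small-seam flag: étale-locally decided, DESCENT SEAM (a)/(b)/(c)], `RankOneRadicands` [UNDECIDED:
embedded resolution of Zariski threefold germs zᵖ = g(v₁,v₂,v₃) in regular 4-space], `DegenerateRadicands` [declared
residual, score 0, not absorbing]) are one-line Props over existing declarations, and the by-name kernels (phase 3,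
`Theorems/QuotientModelsHessianLadder.lean`: closes, srm4_iff 4-way exact, srm4_of_root, cumulative rungs,
tameRadicands_of_core) can import both.  It does NOT import the route file (no cycle).
Pointwise levels: A `NonCriticalAt` (regular upstairs: tree `AdjoinRoot.isRegularLocalRing_X_pow_sub_C`), B `MonomialAt`
(Kummer / log-regular, tree `Kato1994_logRegular_hasResolution_holds`), C `HyperbolicAt`, D `RankOneAt`; presentations
on a proper model (`TamePresentation` ⊆ `HyperbolicPresentation` ⊆ `RankOnePresentation`, kernels); classes of the
extension `K/L` (`TameClass` ⊆ `HyperbolicClass` ⊆ `RankOneClass`, kernels) — predicates on K/L, not on a model, hence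
immune to the DominationDichotomy barrier (Theorems/DominanceDominationDichotomy.lean).  Instrument: HOME/decomp-res-
lens-1/g5/hessian/T-hessian-0.md (+ §T-hessian-1; desk).  [CossartPiltant2019; Kato1994; hauser2024 p.2]
-/

namespace Summit.ResolutionOfSingularities.ResolutionOfSingularities.Theorems.RadicandHessianClasses

open AlgebraicGeometry Literature.AlgebraicGeometry.Resolution

/-! ## Pointwise classes of a representative `x ∈ 𝒪_{N,y}` of the radicand -/

section Pointwise

variable {R : Type} [CommRing R] [IsLocalRing R]

/-- Level A — NON-CRITICAL: every `p`-th-power shift of `x` that vanishes at the point has order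
exactly one.  (If no shift vanishes, `x(y) ∉ κ(y)ᵖ` and the root cover is regular over `y` with
residue field `κ(y)(x(y)^{1/p})`; if one shift has order one, all vanishing shifts do, since
`(t − t′)ᵖ ∈ 𝔪²`.)  Regularity upstairs: `AdjoinRoot.isRegularLocalRing_X_pow_sub_C` (tree). -/
def NonCriticalAt (p : ℕ) (x : R) : Prop :=
  ∀ t : R, x - t ^ p ∈ IsLocalRing.maximalIdeal R → x - t ^ p ∉ IsLocalRing.maximalIdeal R ^ 2

/-- A regular system of parameters of length four (tree convention, `RegularSystemOfParameters`:
generators of `𝔪` in number `spanFinrank 𝔪`). -/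
def IsRsopFour (y : Fin 4 → R) : Prop :=
  Ideal.span (Set.range y) = IsLocalRing.maximalIdeal R ∧
    (IsLocalRing.maximalIdeal R).spanFinrank = 4

/-- Level B — PURE MONOMIAL: a shift of `x` is a monomial in a regular system of parameters (the
unit is absorbed into a parameter; a unit-monomial `ε·yᵐ` with some `p ∤ mᵢ` becomes level A/B
after the generator change `a ↦ aᵅ·s`, `α mᵢ − p β = 1`).  Upstairs: a Kummer cover of a
log-regular pair, log-regular after normalization (`KummerChartLogRegular`), resolved by
`Kato1994_logRegular_hasResolution_holds` (tree). -/
def MonomialAt (p : ℕ) (x : R) : Prop :=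
  ∃ (t : R) (y : Fin 4 → R) (m : Fin 4 → ℕ), IsRsopFour y ∧ x - t ^ p = ∏ i, y i ^ m i

/-- Level C — HYPERBOLIC critical point: `x − tᵖ ≡ y₀y₁ + q′(y₂,y₃) (mod 𝔪³)` for some regular
system of parameters (polar rank `≥ 2` with a split hyperbolic plane; any `p`, including `2`). -/
def HyperbolicAt (p : ℕ) (x : R) : Prop :=
  ∃ (t : R) (y : Fin 4 → R), IsRsopFour y ∧
    x - t ^ p - y 0 * y 1 ∈ Ideal.span {y 2, y 3} ^ 2 ⊔ IsLocalRing.maximalIdeal R ^ 3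

/-- Level D — RANK-ONE critical point: `x − tᵖ ≡ c·y₀² (mod 𝔪³)`, `c` a unit (for `p = 2` this is
absorbed into order `≥ 3` over a perfect residue field). -/
def RankOneAt (p : ℕ) (x : R) : Prop :=
  ∃ (t c : R) (y : Fin 4 → R), IsRsopFour y ∧ c ∉ IsLocalRing.maximalIdeal R ∧
    x - t ^ p - c * y 0 ^ 2 ∈ IsLocalRing.maximalIdeal R ^ 3

end Pointwise

/-! ## Presentations of the radicand on a regular proper model of `L` -/

section Presentations

variable {k L : Type} [Field k] [Field L] [Algebra k L]

/-- The generic point lies in every open containing a point. -/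
theorem genericPoint_mem (N : ProperModel.{0} k L) {U : N.X.Opens} {y : N.X} (hy : y ∈ U) :
    genericPoint N.X ∈ U :=
  ((genericPoint_spec N.X).mem_open_set_iff U.isOpen).mpr ⟨y, Set.mem_univ _, hy⟩

/-- A section `g ∈ Γ(N, U)` read in the function field `L` of the model. -/
noncomputable def sectionToField (N : ProperModel.{0} k L) (U : N.X.Opens) {y : N.X}
    (hy : y ∈ U) (g : Γ(N.X, U)) : L :=
  N.funFieldAlgEquiv ((N.X.presheaf.germ U (genericPoint N.X) (genericPoint_mem N hy)).hom g)

/-- TAME PRESENTATION of the radicand `b ∈ L` on `N`: at every closed point `y` some `b·sᵖ`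
(`s ∈ L`, `s ≠ 0`) is the image of a section `g` regular near `y` whose germ at `y` is non-critical (A)
or pure monomial (B). -/
def TamePresentation (p : ℕ) (N : ProperModel.{0} k L) (b : L) : Prop :=
  ∀ y : N.X, IsClosed ({y} : Set N.X) →
    ∃ (U : N.X.Opens) (hy : y ∈ U) (g : Γ(N.X, U)) (s : L), s ≠ 0 ∧
      sectionToField N U hy g = b * s ^ p ∧
      (NonCriticalAt p ((N.X.presheaf.germ U y hy).hom g) ∨
       MonomialAt p ((N.X.presheaf.germ U y hy).hom g))

/-- HYPERBOLIC PRESENTATION of the radicand `b ∈ L` on `N`: at every closed point `y` some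
`b·sᵖ` (`s ∈ L`, `s ≠ 0`) is the image of a section `g` regular near `y` whose germ at `y` is
non-critical (A) or pure monomial (B) or a hyperbolic critical point ISOLATED among the closed
points of the chart (C). -/
def HyperbolicPresentation (p : ℕ) (N : ProperModel.{0} k L) (b : L) : Prop :=
  ∀ y : N.X, IsClosed ({y} : Set N.X) →
    ∃ (U : N.X.Opens) (hy : y ∈ U) (g : Γ(N.X, U)) (s : L), s ≠ 0 ∧
      sectionToField N U hy g = b * s ^ p ∧
      (NonCriticalAt p ((N.X.presheaf.germ U y hy).hom g) ∨
       MonomialAt p ((N.X.presheaf.germ U y hy).hom g) ∨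
       (HyperbolicAt p ((N.X.presheaf.germ U y hy).hom g) ∧
         ∀ (y' : N.X) (hy' : y' ∈ U), IsClosed ({y'} : Set N.X) → y' ≠ y →
           NonCriticalAt p ((N.X.presheaf.germ U y' hy').hom g)))

/-- RANK-ONE PRESENTATION: as above, the menu enlarged by ISOLATED rank-one critical points (D). -/
def RankOnePresentation (p : ℕ) (N : ProperModel.{0} k L) (b : L) : Prop :=
  ∀ y : N.X, IsClosed ({y} : Set N.X) →
    ∃ (U : N.X.Opens) (hy : y ∈ U) (g : Γ(N.X, U)) (s : L), s ≠ 0 ∧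
      sectionToField N U hy g = b * s ^ p ∧
      (NonCriticalAt p ((N.X.presheaf.germ U y hy).hom g) ∨
       MonomialAt p ((N.X.presheaf.germ U y hy).hom g) ∨
       ((HyperbolicAt p ((N.X.presheaf.germ U y hy).hom g) ∨
          RankOneAt p ((N.X.presheaf.germ U y hy).hom g)) ∧
         ∀ (y' : N.X) (hy' : y' ∈ U), IsClosed ({y'} : Set N.X) → y' ≠ y →
           NonCriticalAt p ((N.X.presheaf.germ U y' hy').hom g)))

/-- The ladder is cumulative pointwise: a tame presentation is a hyperbolic presentation. -/
theorem hyperbolicPresentation_of_tame {p : ℕ} {N : ProperModel.{0} k L} {b : L}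
    (h : TamePresentation p N b) : HyperbolicPresentation p N b := by
  intro y hyc
  obtain ⟨U, hy, g, s, hs, hg, hmenu⟩ := h y hyc
  refine ⟨U, hy, g, s, hs, hg, ?_⟩
  rcases hmenu with hA | hB
  · exact Or.inl hA
  · exact Or.inr (Or.inl hB)

/-- The ladder is cumulative pointwise: a hyperbolic presentation is a rank-one presentation. -/
theorem rankOnePresentation_of_hyperbolic {p : ℕ} {N : ProperModel.{0} k L} {b : L}
    (h : HyperbolicPresentation p N b) : RankOnePresentation p N b := by
  intro y hyc
  obtain ⟨U, hy, g, s, hs, hg, hmenu⟩ := h y hyc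
  refine ⟨U, hy, g, s, hs, hg, ?_⟩
  rcases hmenu with hA | hB | ⟨hC, hiso⟩
  · exact Or.inl hA
  · exact Or.inr (Or.inl hB)
  · exact Or.inr (Or.inr ⟨Or.inl hC, hiso⟩)

end Presentations

/-! ## Instance classes (properties of the extension `K/L`, not of a model) -/

section Classes

/-- `K/L` is in the TAME class: some generator `a'` (`K = L(a')`, radicand `b' = a'ᵖ ∈ L`) admits
a tame presentation (non-critical | pure monomial at every closed point) on some regular proper model
of `L`. -/
def TameClass (p : ℕ) (k L K : Type) [Field k] [Field L] [Field K] [Algebra k L] [Algebra L K] : Prop :=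
  ∃ (a' : K) (b' : L), IntermediateField.adjoin L ({a'} : Set K) = ⊤ ∧
    algebraMap L K b' = a' ^ p ∧
    ∃ N : ProperModel.{0} k L, Scheme.IsRegular N.X ∧ TamePresentation p N b'

/-- `K/L` is in the HYPERBOLIC class: some generator `a'` (`K = L(a')`, radicand `b' = a'ᵖ ∈ L`)
admits a hyperbolic presentation on some regular proper model of `L`. -/
def HyperbolicClass (p : ℕ) (k L K : Type) [Field k] [Field L] [Field K] [Algebra k L] [Algebra L K] : Prop :=
  ∃ (a' : K) (b' : L), IntermediateField.adjoin L ({a'} : Set K) = ⊤ ∧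
    algebraMap L K b' = a' ^ p ∧
    ∃ N : ProperModel.{0} k L, Scheme.IsRegular N.X ∧ HyperbolicPresentation p N b'

/-- `K/L` is in the RANK-ONE class (cumulative: contains the hyperbolic class). -/
def RankOneClass (p : ℕ) (k L K : Type) [Field k] [Field L] [Field K] [Algebra k L] [Algebra L K] : Prop :=
  ∃ (a' : K) (b' : L), IntermediateField.adjoin L ({a'} : Set K) = ⊤ ∧
    algebraMap L K b' = a' ^ p ∧
    ∃ N : ProperModel.{0} k L, Scheme.IsRegular N.X ∧ RankOnePresentation p N b'

/-- Cumulativity of the classes: tame ⊆ hyperbolic. -/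
theorem hyperbolicClass_of_tameClass {p : ℕ} {k L K : Type} [Field k] [Field L] [Field K] [Algebra k L]
    [Algebra L K] (h : TameClass p k L K) : HyperbolicClass p k L K := by
  obtain ⟨a', b', htop, hb, N, hN, hpres⟩ := h
  exact ⟨a', b', htop, hb, N, hN, hyperbolicPresentation_of_tame hpres⟩

/-- Cumulativity of the classes: hyperbolic ⊆ rank-one. -/
theorem rankOneClass_of_hyperbolicClass {p : ℕ} {k L K : Type} [Field k] [Field L] [Field K]
    [Algebra k L] [Algebra L K] (h : HyperbolicClass p k L K) : RankOneClass p k L K := by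
  obtain ⟨a', b', htop, hb, N, hN, hpres⟩ := h
  exact ⟨a', b', htop, hb, N, hN, rankOnePresentation_of_hyperbolic hpres⟩

end Classes

end Summit.ResolutionOfSingularities.ResolutionOfSingularities.Theorems.RadicandHessianClasses
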